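import Mathlib
import Summits.ValiantsHypothesis.ValiantsHypothesis.Theses.GeneratorObstructions

/-!
# `GeneratorObstructions.Assembly` (stmt-ValiantsHypothesis-11664) — assembly of route GeneratorObstructions

The route's assembly item `Assembly`:
`GenFlipThesis → GenPrinciple → PowTraceMembership → PerPowTraceQP → ValiantsHypothesis`.
This is pure logic and is literally the type of the route's (sorry-free) deciding theorem
`Summit.ValiantsHypothesis.ValiantsHypothesis.Theses.GeneratorObstructions.closes`: assuming
`VP ℂ = VNP ℂ`, the permanent family is a `VP` family (`perFamily_mem_VNP_holds`,
`mem_VP_ofFintype_iff_holds`); `PerPowTraceQP` gives a constant `c` and, for every `m ≥ 1`, a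
trace-power representation `per_m = tr(A^m)` of size `n = m + e ≤ 2^((log₂ m + c)^c)`;
`GenFlipThesis` at that `c` gives such an `m` and, at that `n`, a weight `χ` with
`γ_χ(tr X^m) < γ_χ(per_m)`; `PowTraceMembership` puts the block permanent in
`closure(GL_(n²) · tr X^m)` and `GenPrinciple` (degree `m ≠ 0`) gives `γ_χ(per_m) ≤ γ_χ(tr X^m)` —
contradiction. Gesmundo–Ikenmeyer–Panova 2017 §2.2; Valiant 1979; Bürgisser 2000. [folklore]
-/

namespace Summit.ValiantsHypothesis.ValiantsHypothesis.Theorems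

-- `Summit.ValiantsHypothesis.ValiantsHypothesis.…` is the tree's mandated single-conjunct layout (Sub = Summit).
set_option linter.dupNamespace false

/-- **`Assembly` holds** (item stmt-ValiantsHypothesis-11664, assembly of route GeneratorObstructions):
`GenFlipThesis → GenPrinciple → PowTraceMembership → PerPowTraceQP → ValiantsHypothesis`.
Pure logic — exactly the route's deciding theorem `GeneratorObstructions.closes` (from
`VP ℂ = VNP ℂ` the permanent is a `VP` family; `PerPowTraceQP` supplies the window constant `c`
and trace-power representations; `GenFlipThesis` a flip `γ_χ(tr X^m) < γ_χ(per_m)` at a window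
size; `PowTraceMembership` + `GenPrinciple` the reverse inequality). [folklore] -/
theorem generatorObstructions_assembly_proof :
    Summit.ValiantsHypothesis.ValiantsHypothesis.Theses.GeneratorObstructions.Assembly := by
  unfold Summit.ValiantsHypothesis.ValiantsHypothesis.Theses.GeneratorObstructions.Assembly
  -- (buildfix 2026-08-28) the route's `closes` was re-keyed (05:46Z) to the typed split K1/K2 + glue, from
  -- which it first DERIVES `GenFlipThesis`; the accepted `Assembly` takes `GenFlipThesis` directly, so the
  -- remainder of the chain of `closes` is inlined verbatim.
  intro hX hP hM hQ
  show Literature.Computability.AlgebraicComplexity.VP ℂ ≠ Literature.Computability.AlgebraicComplexity.VNP ℂ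
  intro hEq
  have hper : Literature.Computability.AlgebraicComplexity.perFamily ℂ ∈
      Literature.Computability.AlgebraicComplexity.VP ℂ := by
    rw [hEq]; exact Literature.Computability.AlgebraicComplexity.perFamily_mem_VNP_holds ℂ
  have hvp : Literature.Computability.AlgebraicComplexity.IsVPFamily
      (fun n => Literature.Computability.AlgebraicComplexity.perPoly (Fin n) ℂ) :=
    (Literature.Computability.AlgebraicComplexity.mem_VP_ofFintype_iff_holds _).1 hper
  obtain ⟨c, hc⟩ := hQ hvp
  obtain ⟨m, -, hm1, hwin⟩ := hX c 0
  obtain ⟨e, hle, hrepr⟩ := hc m hm1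
  obtain ⟨χ, hχ⟩ := hwin e hle
  have hmem := hM m e (m + e) hm1 le_rfl hrepr
  have hle' := hP _ _ m (by omega) hmem χ
  exact absurd hχ (not_lt.mpr hle')

end Summit.ValiantsHypothesis.ValiantsHypothesis.Theorems
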